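import Summits.AtomisticToContinuum.Crystallization.Theorems.FrustratedLawDichotomyStrainedPatchCoreTubeMilli
import Summits.AtomisticToContinuum.Crystallization.Theorems.FrustratedLawDichotomyPeriodicBlockFlags

/-!
# `[CORE-FAR]` cut by the STRAIN BAND of the centre, with the SLAVED FIRST-ORDER ENVELOPE as the engine of the stable bands («StrainBands», lens-5 g50)

Lens-5 («finite / base range + asymptotic regime + bridge») node under «CoreTubeRecord» / «CoreTubeMilli» (g47, tree) on the 27623 T-side piece
`StrainedPatchRec`.  TARGET OF RECORD (critic ROWS 849 (d) / 867 / 880): `CoreOffTubeFloor (63/10) (63/10) (24/5) (1/100) (1/1000)` **[CORE-FAR]** — every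
admissible cluster clean within `63/10`, of one stacking word, whose `24/5`-core is `1/100`-far (modulo isometry) from every admissible homogeneous instance
scores `≥ 1/1000` (PROVISIONAL; the assembly `…CoreTubeRecord.strainedPatchRec_of_homFloor_of_tailPenalty_of_coreRelief_of_coreOff_…` consumes ANY floor `φ₁ ≥ 0`).

WHAT THE INSTRUMENTS SAY (g49 SUSCEPT49, g50 SLACK50; `run/shared/lean/pub/decomp-a2c/decomp-a2c-lens-5/g50/out/SLACK50.md`).  The score of a near-homogeneous
admissible cluster moves at FIRST order in its non-affinity (odd sector; raw `‖∇S‖₁ ≈ 0.63–0.95`, so no unslaved Taylor bound can pay even the defining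
non-affinity `1/100`).  What keeps the first-order drop small is the FORCE CAP of `Admissible`: the capped interior is slaved to the uncapped annulus
(`u_I = H_II⁻¹(f − H_IB u_B)`, `|f| ≤ σ₁`), leaving two small columns — roughness of the uncapped annulus (`‖g_na‖₁·room`, g49) and force slack (`σ₁‖w_na‖₁`,
g50: 7.8e-4 at the hcp edge host … 1.6e-3 mid-window, against margins 1.08e-3 … 1.08e-2).  Both columns are governed by WHERE IN THE WINDOW `(1/20, 1/8]` the
chart sits: at the lower EDGE the one-sided window is a CONE that blocks both freedoms (HZ00: the slack pattern drives 28/103 core misfits below `1/20`);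
MID-window both act, combined linear budget ≈ 0.55–0.68 of the margin; at the SOFT end the interior Hessian of the admissible homogeneous host goes INDEFINITE
(FZ12, η = .1196, confirmed at two cutoffs) and no linear envelope exists.  Three regimes, three engines — hence this node's cut variable.

THE CUT (§1, exact, by `em` on the centre's capped fit `GoodAtScale η (3/2) z c`): `[CORE-FAR](φ) ⟺ EdgeFarFloor η₁ ∧ BandFarFloor η₁ η₂ ∧ SoftFarFloor η₂`
(every `η₁, η₂`).  THE LENS IDIOM, PROVED: both ENDS are vacuous bases — `EdgeFarFloor … (1/20) φ` holds outright (an admissible centre is never `1/20`-tight: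
`Admissible` carries `¬TightNearCap (9/5) (3/2)`), `SoftFarFloor … (1/8) φ` holds outright (a clean centre is `1/8`-good) — the edge range grows UPWARD from
`1/20` (antitone ladder), the soft range grows DOWNWARD from `1/8` (monotone ladder), and WHEN THEY MEET the target follows (`coreOff_of_edge_of_soft`: `η₂ ≤ η₁`),
the middle band being vacuous.  At the far ends each range IS the target (`coreOff_iff_soft_twentieth`, `coreOff_iff_edge_eighth`).

THE ENGINE OF THE STABLE BANDS (§2, critic ROW 880 docket (E1)(E2)(E3), typed WITHOUT a supremum over hosts): coefficient TABLES indexed by the admissible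
homogeneous INSTANCE `(M₀, z₀, c₀)` of the tree (fcc AND two-sublattice hcp with free shift — this is what replaces «host» for non-Bravais cores), quantified
UNIVERSALLY by the node and pinned only by the certificate: (E1) `SlavedEnvelope τ ℓ s q` — every record cluster coarsely charted (tolerance `τ`, the basin) by an
instance, with deviation `≤ t` on the UNCAPPED part of the `63/10`-ball, scores `≥ S(z₀) − ℓ(z₀)·t − s(z₀)·σ₁ − q(z₀)·t²` [ANALYTIC: uniform invertibility and
decay of the capped-interior Hessian; TRUE-type on the linearly stable range, VOID beyond the instability onset]; (E2) `ChartRoom ρ ε η₂ η₃ τ κ κ₁` — a far-class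
cluster whose centre is `η₂`-good admits, modulo isometry, such a chart by an `η₃`-good instance with `t = κ·windowRoom(z₀) + κ₁·σ₁` [GEOMETRIC, Schmidt–Müller
type, includes the edge cone through `windowRoom → 0`]; (E3) `EnvelopeCert η₃ κ κ₁ φ ℓ s q` — on every `η₃`-good admissible homogeneous instance
`S(z₀) − ℓ·(κ·room + κ₁σ₁) − s·σ₁ − q·(κ·room + κ₁σ₁)² ≥ φ` [CERT-type, INSTRUMENTABLE: the landed (H) box tree plus two susceptibility columns; at zero tables it
IS `HomFloor` restricted, `envelopeCert_zero_of_homFloor`].  SEAM (pure inequalities + isometry invariance): (E1) ∧ (E2) ∧ (E3) ⟹ `EdgeFarFloor (63/10) (63/10) ρ ε η₂ φ`;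
with `SoftFarFloor … η₂ φ` [RESIDUAL: the soft end — stability of the admissible homogeneous family + nonlinear relaxation inside the upper-edge cone against a
large margin; UNDECIDED, INSTRUMENTABLE = census L5-ASK8⁺/13] the target, and through the tree's record assembly `StrainedPatchRec` (§3).  Lean fixes no
census number: `η₂, η₃, τ, κ, κ₁, φ` and the tables stay parameters (ROW 800 practice).  No new axioms, no cite tokens, no instances / notation.
-/

namespace Summit.AtomisticToContinuum.Crystallization.Theorems.FrustratedLawDichotomyStrainedPatchStrainBands

open scoped BigOperators Classical
open Summit.AtomisticToContinuum.Crystallization.Theorems.FrustratedLawDichotomyMotifLemmas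
open Summit.AtomisticToContinuum.Crystallization.Theorems.FrustratedLawDichotomyAveragingCut
open Summit.AtomisticToContinuum.Crystallization.Theorems.FrustratedLawDichotomyAveragingRuleCap
open Summit.AtomisticToContinuum.Crystallization.Theorems.FrustratedLawDichotomyAveragingRuleTightFree
open Summit.AtomisticToContinuum.Crystallization.Theorems.FrustratedLawDichotomyExemptDoor (SitePred)
open Summit.AtomisticToContinuum.Crystallization.Theorems.FrustratedLawDichotomyExemptAbsorption
open Summit.AtomisticToContinuum.Crystallization.Theorems.FrustratedLawDichotomyExemptAbsorptionRecord
open Summit.AtomisticToContinuum.Crystallization.Theorems.FrustratedLawDichotomyCollarCensus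
open Summit.AtomisticToContinuum.Crystallization.Theorems.FrustratedLawDichotomyPeriodicBlockFlags (goodAtScale_mono)
open Summit.AtomisticToContinuum.Crystallization.Theorems.FrustratedLawDichotomyCollarCensusKappa
open Summit.AtomisticToContinuum.Crystallization.Theorems.FrustratedLawDichotomyStrainedPatchHomSplit
open Summit.AtomisticToContinuum.Crystallization.Theorems.FrustratedLawDichotomyStrainedPatchCleanCollar
open Summit.AtomisticToContinuum.Crystallization.Theorems.FrustratedLawDichotomyStrainedPatchHomTube
open Summit.AtomisticToContinuum.Crystallization.Theorems.FrustratedLawDichotomyStrainedPatchHomIsometry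
open Summit.AtomisticToContinuum.Crystallization.Theorems.FrustratedLawDichotomyStrainedPatchHomTubeIso
open Summit.AtomisticToContinuum.Crystallization.Theorems.FrustratedLawDichotomyStrainedPatchPhaseCut
open Summit.AtomisticToContinuum.Crystallization.Theorems.FrustratedLawDichotomyStrainedPatchCoreTube
open Summit.AtomisticToContinuum.Crystallization.Theorems.FrustratedLawDichotomyStrainedPatchCoreTubeRecord
open Summit.AtomisticToContinuum.Crystallization.Theorems.FrustratedLawDichotomyStrainedPatchCoreTubeMilli

/-! ## §1. The far class cut by the strain band of the centre; vacuous bases at both window ends; ladders; the meet -/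

/-- **`EdgeFarFloor r r₁ ρ ε η₁ φ` [CORE-FAR restricted to the EDGE band]** — the far-class clusters whose CENTRE is `η₁`-good at capped fit scale `3/2`
(12-shell misfit below `η₁`, i.e. within `η₁ − 1/20` of the window's lower edge) score `≥ φ`. -/
def EdgeFarFloor (r r₁ ρ ε η₁ φ : ℝ) : Prop :=
  ∀ (M : ℕ) (z : Fin M → E3) (c : Fin M), Admissible M z c → CleanBall r z c → MonoPhaseBall r₁ z c → ¬NearHomIsoAt ρ ε z c →
    GoodAtScale η₁ (3 / 2) z c → φ ≤ ballAvg (9 / 5) z (xRec M z) c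

/-- **`SoftFarFloor r r₁ ρ ε η₂ φ` [CORE-FAR restricted to the SOFT band]** — the far-class clusters whose centre is NOT `η₂`-good (misfit at least `η₂`: the
upper, mechanically soft part of the window) score `≥ φ`. -/
def SoftFarFloor (r r₁ ρ ε η₂ φ : ℝ) : Prop :=
  ∀ (M : ℕ) (z : Fin M → E3) (c : Fin M), Admissible M z c → CleanBall r z c → MonoPhaseBall r₁ z c → ¬NearHomIsoAt ρ ε z c →
    ¬GoodAtScale η₂ (3 / 2) z c → φ ≤ ballAvg (9 / 5) z (xRec M z) c

/-- **`BandFarFloor r r₁ ρ ε η₁ η₂ φ` [CORE-FAR restricted to the MIDDLE band]** — centre NOT `η₁`-good but `η₂`-good (misfit in `[η₁, η₂)`). -/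
def BandFarFloor (r r₁ ρ ε η₁ η₂ φ : ℝ) : Prop :=
  ∀ (M : ℕ) (z : Fin M → E3) (c : Fin M), Admissible M z c → CleanBall r z c → MonoPhaseBall r₁ z c → ¬NearHomIsoAt ρ ε z c →
    ¬GoodAtScale η₁ (3 / 2) z c → GoodAtScale η₂ (3 / 2) z c → φ ≤ ballAvg (9 / 5) z (xRec M z) c

/-- ★ EXACT TWO-BAND CUT (every `η`): `CoreOffTubeFloor r r₁ ρ ε φ ↔ EdgeFarFloor r r₁ ρ ε η φ ∧ SoftFarFloor r r₁ ρ ε η φ`. [folklore: `em`] -/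
theorem coreOff_iff_edge_and_soft (r r₁ ρ ε η φ : ℝ) : CoreOffTubeFloor r r₁ ρ ε φ ↔ EdgeFarFloor r r₁ ρ ε η φ ∧ SoftFarFloor r r₁ ρ ε η φ := by
  constructor
  · exact fun h => ⟨fun M z c hz hcl hm hn _ => h M z c hz hcl hm hn, fun M z c hz hcl hm hn _ => h M z c hz hcl hm hn⟩
  · rintro ⟨hE, hS⟩ M z c hz hcl hm hn
    by_cases hg : GoodAtScale η (3 / 2) z c
    · exact hE M z c hz hcl hm hn hg
    · exact hS M z c hz hcl hm hn hg

/-- ★ EXACT THREE-BAND CUT (every `η₁, η₂`, no order hypothesis):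
`CoreOffTubeFloor r r₁ ρ ε φ ↔ EdgeFarFloor … η₁ φ ∧ BandFarFloor … η₁ η₂ φ ∧ SoftFarFloor … η₂ φ`. [folklore: `em` twice] -/
theorem coreOff_iff_edge_band_soft (r r₁ ρ ε η₁ η₂ φ : ℝ) :
    CoreOffTubeFloor r r₁ ρ ε φ ↔ EdgeFarFloor r r₁ ρ ε η₁ φ ∧ BandFarFloor r r₁ ρ ε η₁ η₂ φ ∧ SoftFarFloor r r₁ ρ ε η₂ φ := by
  constructor
  · exact fun h => ⟨fun M z c hz hcl hm hn _ => h M z c hz hcl hm hn, fun M z c hz hcl hm hn _ _ => h M z c hz hcl hm hn,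
      fun M z c hz hcl hm hn _ => h M z c hz hcl hm hn⟩
  · rintro ⟨hE, hB, hS⟩ M z c hz hcl hm hn
    by_cases h₁ : GoodAtScale η₁ (3 / 2) z c
    · exact hE M z c hz hcl hm hn h₁
    · by_cases h₂ : GoodAtScale η₂ (3 / 2) z c
      · exact hB M z c hz hcl hm hn h₁ h₂
      · exact hS M z c hz hcl hm hn h₂

/-- NECESSITY: each band is a restriction of the target. [formal bookkeeping] -/
theorem edgeFar_of_coreOff {r r₁ ρ ε φ : ℝ} (η₁ : ℝ) (h : CoreOffTubeFloor r r₁ ρ ε φ) : EdgeFarFloor r r₁ ρ ε η₁ φ :=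
  ((coreOff_iff_edge_and_soft r r₁ ρ ε η₁ φ).1 h).1

/-- The core-off tube floor implies the soft far floor (any `η₂`). [formal bookkeeping] -/
theorem softFar_of_coreOff {r r₁ ρ ε φ : ℝ} (η₂ : ℝ) (h : CoreOffTubeFloor r r₁ ρ ε φ) : SoftFarFloor r r₁ ρ ε η₂ φ :=
  ((coreOff_iff_edge_and_soft r r₁ ρ ε η₂ φ).1 h).2

/-- The core-off tube floor implies the band far floor (any `η₁ η₂`). [formal bookkeeping] -/
theorem bandFar_of_coreOff {r r₁ ρ ε φ : ℝ} (η₁ η₂ : ℝ) (h : CoreOffTubeFloor r r₁ ρ ε φ) : BandFarFloor r r₁ ρ ε η₁ η₂ φ :=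
  ((coreOff_iff_edge_band_soft r r₁ ρ ε η₁ η₂ φ).1 h).2.1

/-- ★ BASE OF THE EDGE RANGE (proved outright): at `η₁ = 1/20` the edge band is EMPTY — an admissible centre is never `1/20`-good at scale `≤ 3/2`
(`Admissible` carries `¬TightNearCap (9/5) (3/2) z c` and `c ∈ ball (9/5) z c`). [formal bookkeeping] -/
theorem edgeFarFloor_twentieth (r r₁ ρ ε φ : ℝ) : EdgeFarFloor r r₁ ρ ε (1 / 20) φ :=
  fun _ z c hz _ _ _ hg => absurd ⟨c, self_mem_ball (by norm_num) z c, hg⟩ hz.2.2.2.1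

/-- ★ BASE OF THE SOFT RANGE (proved outright, `r ≥ 0`): at `η₂ = 1/8` the soft band is EMPTY — the centre of a clean ball is `1/8`-good. [formal bookkeeping] -/
theorem softFarFloor_eighth {r : ℝ} (hr : 0 ≤ r) (r₁ ρ ε φ : ℝ) : SoftFarFloor r r₁ ρ ε (1 / 8) φ :=
  fun _ z c _ hcl _ _ hng => absurd (hcl c (by rw [dist_self]; exact hr)) hng

/-- EDGE LADDER: the edge band grows with `η₁`, so the statement is ANTITONE in `η₁`. [folklore] -/
theorem EdgeFarFloor.anti {r r₁ ρ ε η₁ η₁' φ : ℝ} (h : EdgeFarFloor r r₁ ρ ε η₁' φ) (hle : η₁ ≤ η₁') : EdgeFarFloor r r₁ ρ ε η₁ φ :=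
  fun M z c hz hcl hm hn hg => h M z c hz hcl hm hn (goodAtScale_mono hle hg)

/-- SOFT LADDER: the soft band shrinks as `η₂` grows, so the statement is MONOTONE in `η₂`. [folklore] -/
theorem SoftFarFloor.mono {r r₁ ρ ε η₂ η₂' φ : ℝ} (h : SoftFarFloor r r₁ ρ ε η₂ φ) (hle : η₂ ≤ η₂') : SoftFarFloor r r₁ ρ ε η₂' φ :=
  fun M z c hz hcl hm hn hng => h M z c hz hcl hm hn fun hg => hng (goodAtScale_mono hle hg)

/-- Below the base the edge statement is free (`η₁ ≤ 1/20`). [formal bookkeeping] -/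
theorem edgeFarFloor_of_le_twentieth {η₁ : ℝ} (hle : η₁ ≤ 1 / 20) (r r₁ ρ ε φ : ℝ) : EdgeFarFloor r r₁ ρ ε η₁ φ :=
  (edgeFarFloor_twentieth r r₁ ρ ε φ).anti hle

/-- Above the base the soft statement is free (`1/8 ≤ η₂`, `r ≥ 0`). [formal bookkeeping] -/
theorem softFarFloor_of_eighth_le {r η₂ : ℝ} (hr : 0 ≤ r) (hle : 1 / 8 ≤ η₂) (r₁ ρ ε φ : ℝ) : SoftFarFloor r r₁ ρ ε η₂ φ :=
  (softFarFloor_eighth hr r₁ ρ ε φ).mono hle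

/-- The floors are antitone in `φ`. [formal bookkeeping] -/
theorem EdgeFarFloor.of_le {r r₁ ρ ε η₁ φ φ' : ℝ} (h : EdgeFarFloor r r₁ ρ ε η₁ φ) (hle : φ' ≤ φ) : EdgeFarFloor r r₁ ρ ε η₁ φ' :=
  fun M z c hz hcl hm hn hg => hle.trans (h M z c hz hcl hm hn hg)

/-- `SoftFarFloor` is antitone in the floor `φ`. [formal bookkeeping] -/
theorem SoftFarFloor.of_le {r r₁ ρ ε η₂ φ φ' : ℝ} (h : SoftFarFloor r r₁ ρ ε η₂ φ) (hle : φ' ≤ φ) : SoftFarFloor r r₁ ρ ε η₂ φ' :=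
  fun M z c hz hcl hm hn hng => hle.trans (h M z c hz hcl hm hn hng)

/-- An inverted band is EMPTY: `η₂ ≤ η₁ ⟹ BandFarFloor … η₁ η₂ φ`. [folklore] -/
theorem bandFarFloor_of_le {η₁ η₂ : ℝ} (hle : η₂ ≤ η₁) (r r₁ ρ ε φ : ℝ) : BandFarFloor r r₁ ρ ε η₁ η₂ φ :=
  fun _ _ _ _ _ _ _ h₁ h₂ => absurd (goodAtScale_mono hle h₂) h₁

/-- ★★ THE MEET (the lens's bridge): when the edge range, grown up to `η₁`, and the soft range, grown down to `η₂ ≤ η₁`, overlap, the target follows. [folklore] -/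
theorem coreOff_of_edge_of_soft {r r₁ ρ ε η₁ η₂ φ : ℝ} (hle : η₂ ≤ η₁) (hE : EdgeFarFloor r r₁ ρ ε η₁ φ) (hS : SoftFarFloor r r₁ ρ ε η₂ φ) :
    CoreOffTubeFloor r r₁ ρ ε φ :=
  (coreOff_iff_edge_band_soft r r₁ ρ ε η₁ η₂ φ).2 ⟨hE, bandFarFloor_of_le hle r r₁ ρ ε φ, hS⟩

/-- At the far end each range IS the target: `CoreOffTubeFloor … φ ↔ SoftFarFloor … (1/20) φ` … [formal bookkeeping] -/
theorem coreOff_iff_soft_twentieth (r r₁ ρ ε φ : ℝ) : CoreOffTubeFloor r r₁ ρ ε φ ↔ SoftFarFloor r r₁ ρ ε (1 / 20) φ :=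
  ⟨softFar_of_coreOff (1 / 20), fun h => (coreOff_iff_edge_and_soft r r₁ ρ ε (1 / 20) φ).2 ⟨edgeFarFloor_twentieth r r₁ ρ ε φ, h⟩⟩

/-- … and `CoreOffTubeFloor … φ ↔ EdgeFarFloor … (1/8) φ` (`r ≥ 0`). [formal bookkeeping] -/
theorem coreOff_iff_edge_eighth {r : ℝ} (hr : 0 ≤ r) (r₁ ρ ε φ : ℝ) : CoreOffTubeFloor r r₁ ρ ε φ ↔ EdgeFarFloor r r₁ ρ ε (1 / 8) φ :=
  ⟨edgeFar_of_coreOff (1 / 8), fun h => (coreOff_iff_edge_and_soft r r₁ ρ ε (1 / 8) φ).2 ⟨h, softFarFloor_eighth hr r₁ ρ ε φ⟩⟩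

/-- A finer edge split: `η₁ ≤ η₂ ⟹ (EdgeFarFloor … η₂ φ ↔ EdgeFarFloor … η₁ φ ∧ BandFarFloor … η₁ η₂ φ)` (edge cone band vs envelope band). [folklore] -/
theorem edgeFar_iff_edge_and_band {r r₁ ρ ε η₁ η₂ φ : ℝ} (hle : η₁ ≤ η₂) :
    EdgeFarFloor r r₁ ρ ε η₂ φ ↔ EdgeFarFloor r r₁ ρ ε η₁ φ ∧ BandFarFloor r r₁ ρ ε η₁ η₂ φ := by
  refine ⟨fun h => ⟨h.anti hle, fun M z c hz hcl hm hn _ h₂ => h M z c hz hcl hm hn h₂⟩, ?_⟩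
  rintro ⟨hE, hB⟩ M z c hz hcl hm hn h₂
  by_cases h₁ : GoodAtScale η₁ (3 / 2) z c
  · exact hE M z c hz hcl hm hn h₁
  · exact hB M z c hz hcl hm hn h₁ h₂

/-! ## §2. The engine of the stable bands: the slaved first-order envelope (E1), chart room (E2), the one-dimensional certificate (E3) -/

/-- The FIT LEVEL of a site: the infimum of the tolerances `η` at which it is `η`-good at capped fit scale `3/2` (its 12-shell misfit; for an admissible clean
centre the set is nonempty, contains `1/8`, and omits `1/20`). -/
noncomputable def fitLevel {M : ℕ} (z : Fin M → E3) (a : Fin M) : ℝ :=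
  sInf {η : ℝ | GoodAtScale η (3 / 2) z a}

/-- The WINDOW ROOM of a cluster at its centre: the distance of the centre's fit level to the nearer edge of the window `(1/20, 1/8]`. -/
noncomputable def windowRoom {M : ℕ} (z : Fin M → E3) (c : Fin M) : ℝ :=
  min (fitLevel z c - 1 / 20) (1 / 8 - fitLevel z c)

/-- **`EnvChart τ t z c z₀ c₀ e`** — `(z₀, c₀)` is an admissible homogeneous instance and `e` a correspondence, centre to centre, injective on the `63/10`-ball and
covering the instance's `(63/10 − τ)`-ball, under which the cluster's `63/10`-ball deviates (in position relative to the centres) by at most `τ` EVERYWHERE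
(a COARSE chart: the basin of the slaved interior) and by at most `t` on its UNCAPPED part — the sites farther than `9/2` from every `9/5`-member, on which
`Admissible` imposes no force cap. -/
def EnvChart (τ t : ℝ) {M : ℕ} (z : Fin M → E3) (c : Fin M) {M₀ : ℕ} (z₀ : Fin M₀ → E3) (c₀ : Fin M₀) (e : Fin M → Fin M₀) : Prop :=
  Admissible M₀ z₀ c₀ ∧ IsHomBall (133 / 10) z₀ c₀ ∧ e c = c₀ ∧
    (∀ a, dist (z a) (z c) ≤ 63 / 10 → dist (z a - z c) (z₀ (e a) - z₀ c₀) ≤ τ) ∧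
    (∀ a, dist (z a) (z c) ≤ 63 / 10 → (∀ j, dist (z j) (z c) ≤ 9 / 5 → 9 / 2 < dist (z a) (z j)) → dist (z a - z c) (z₀ (e a) - z₀ c₀) ≤ t) ∧
    (∀ a b, dist (z a) (z c) ≤ 63 / 10 → dist (z b) (z c) ≤ 63 / 10 → e a = e b → a = b) ∧
    (∀ b₀, dist (z₀ b₀) (z₀ c₀) ≤ 63 / 10 - τ → ∃ a, dist (z a) (z c) ≤ 63 / 10 ∧ e a = b₀)

/-- **(E1) `SlavedEnvelope τ ℓ s q` [ANALYTIC — uniform invertibility and decay of the capped-interior Hessian on the admissible homogeneous family]** — with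
coefficient TABLES `ℓ, s, q` indexed by the instance: every admissible record cluster (clean and single-word out to `63/10`) coarsely charted by `(z₀, c₀)` with
uncapped deviation `≤ t` (`t ≥ 0`) scores at least `S(z₀) − ℓ(z₀)·t − s(z₀)·σ₁ − q(z₀)·t²`: the capped interior costs nothing at first order beyond the slack
column `s·σ₁` (`w = H_II⁻¹∇_I S`), the uncapped annulus costs `ℓ·t` (`g_na`), curvature `q·t²`. -/
def SlavedEnvelope (τ : ℝ) (ℓ s q : (M₀ : ℕ) → (Fin M₀ → E3) → Fin M₀ → ℝ) : Prop :=
  ∀ (M : ℕ) (z : Fin M → E3) (c : Fin M) (M₀ : ℕ) (z₀ : Fin M₀ → E3) (c₀ : Fin M₀) (e : Fin M → Fin M₀) (t : ℝ),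
    Admissible M z c → CleanBall (63 / 10) z c → MonoPhaseBall (63 / 10) z c → 0 ≤ t → EnvChart τ t z c z₀ c₀ e →
      ballAvg (9 / 5) z₀ (xRec M₀ z₀) c₀ - ℓ M₀ z₀ c₀ * t - s M₀ z₀ c₀ * sigmaOne - q M₀ z₀ c₀ * t ^ 2 ≤ ballAvg (9 / 5) z (xRec M z) c

/-- **(E2) `ChartRoom ρ ε η₂ η₃ τ κ κ₁` [GEOMETRIC — chart room incl. the edge cone]** — every far-class record cluster whose centre is `η₂`-good admits, modulo a
linear isometry, a coarse chart (tolerance `τ`) by an `η₃`-good admissible homogeneous instance whose uncapped deviation is at most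
`κ·windowRoom(z₀) + κ₁·σ₁ ≥ 0` — roughness is paid for by the window room of the chart, slack-induced mismatch by `σ₁`. -/
def ChartRoom (ρ ε η₂ η₃ τ κ κ₁ : ℝ) : Prop :=
  ∀ (M : ℕ) (z : Fin M → E3) (c : Fin M), Admissible M z c → CleanBall (63 / 10) z c → MonoPhaseBall (63 / 10) z c → ¬NearHomIsoAt ρ ε z c →
    GoodAtScale η₂ (3 / 2) z c →
      ∃ (R : E3 ≃ₗᵢ[ℝ] E3) (M₀ : ℕ) (z₀ : Fin M₀ → E3) (c₀ : Fin M₀) (e : Fin M → Fin M₀), GoodAtScale η₃ (3 / 2) z₀ c₀ ∧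
        0 ≤ κ * windowRoom z₀ c₀ + κ₁ * sigmaOne ∧ EnvChart τ (κ * windowRoom z₀ c₀ + κ₁ * sigmaOne) (⇑R ∘ z) c z₀ c₀ e

/-- **(E3) `EnvelopeCert η₃ κ κ₁ φ ℓ s q` [CERTIFICATE — one-dimensional over the homogeneous family, INSTRUMENTABLE]** — on every `η₃`-good admissible
homogeneous instance the enveloped score clears the floor: `S(z₀) − ℓ(z₀)·(κ·room + κ₁σ₁) − s(z₀)·σ₁ − q(z₀)·(κ·room + κ₁σ₁)² ≥ φ`. -/
def EnvelopeCert (η₃ κ κ₁ φ : ℝ) (ℓ s q : (M₀ : ℕ) → (Fin M₀ → E3) → Fin M₀ → ℝ) : Prop :=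
  ∀ (M₀ : ℕ) (z₀ : Fin M₀ → E3) (c₀ : Fin M₀), Admissible M₀ z₀ c₀ → IsHomBall (133 / 10) z₀ c₀ → GoodAtScale η₃ (3 / 2) z₀ c₀ →
    φ ≤ ballAvg (9 / 5) z₀ (xRec M₀ z₀) c₀ - ℓ M₀ z₀ c₀ * (κ * windowRoom z₀ c₀ + κ₁ * sigmaOne) - s M₀ z₀ c₀ * sigmaOne -
      q M₀ z₀ c₀ * (κ * windowRoom z₀ c₀ + κ₁ * sigmaOne) ^ 2

/-- ★★ THE SEAM OF THE STABLE BANDS: (E1) ∧ (E2) ∧ (E3) ⟹ `EdgeFarFloor (63/10) (63/10) ρ ε η₂ φ` (chart the rotated cluster, envelope it, certify the chart;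
the score is isometry invariant). [folklore] -/
theorem edgeFar_of_envelope_of_room_of_cert {ρ ε η₂ η₃ τ κ κ₁ φ : ℝ} {ℓ s q : (M₀ : ℕ) → (Fin M₀ → E3) → Fin M₀ → ℝ}
    (hE : SlavedEnvelope τ ℓ s q) (hR : ChartRoom ρ ε η₂ η₃ τ κ κ₁) (hC : EnvelopeCert η₃ κ κ₁ φ ℓ s q) :
    EdgeFarFloor (63 / 10) (63 / 10) ρ ε η₂ φ := by
  intro M z c hz hcl hm hn hg
  obtain ⟨R, M₀, z₀, c₀, e, hg₃, ht, hch⟩ := hR M z c hz hcl hm hn hg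
  have h₁ := hE M (⇑R ∘ z) c M₀ z₀ c₀ e _ ((admissible_comp_iff R z c).2 hz) ((cleanBall_comp_iff R z c).2 hcl)
    ((monoPhaseBall_comp_iff R z c).2 hm) ht hch
  rw [ballAvg_xRec_comp] at h₁
  have h₃ := hC M₀ z₀ c₀ hch.1 hch.2.1 hg₃
  linarith

/-- ★★ THE NODE: (E1) ∧ (E2) ∧ (E3) ∧ `SoftFarFloor (63/10) (63/10) ρ ε η₂ φ` [RESIDUAL: the soft end] ⟹ `CoreOffTubeFloor (63/10) (63/10) ρ ε φ`. [folklore] -/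
theorem coreOff_of_envelope_of_room_of_cert_of_soft {ρ ε η₂ η₃ τ κ κ₁ φ : ℝ} {ℓ s q : (M₀ : ℕ) → (Fin M₀ → E3) → Fin M₀ → ℝ}
    (hE : SlavedEnvelope τ ℓ s q) (hR : ChartRoom ρ ε η₂ η₃ τ κ κ₁) (hC : EnvelopeCert η₃ κ κ₁ φ ℓ s q)
    (hS : SoftFarFloor (63 / 10) (63 / 10) ρ ε η₂ φ) : CoreOffTubeFloor (63 / 10) (63 / 10) ρ ε φ :=
  (coreOff_iff_edge_and_soft _ _ ρ ε η₂ φ).2 ⟨edgeFar_of_envelope_of_room_of_cert hE hR hC, hS⟩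

/-- Had the envelope engine reached the top of the window (`η₂ = 1/8`: no instability), it would give the whole target (the soft base is vacuous). [folklore] -/
theorem coreOff_of_envelope_of_room_eighth_of_cert {ρ ε η₃ τ κ κ₁ φ : ℝ} {ℓ s q : (M₀ : ℕ) → (Fin M₀ → E3) → Fin M₀ → ℝ}
    (hE : SlavedEnvelope τ ℓ s q) (hR : ChartRoom ρ ε (1 / 8) η₃ τ κ κ₁) (hC : EnvelopeCert η₃ κ κ₁ φ ℓ s q) :
    CoreOffTubeFloor (63 / 10) (63 / 10) ρ ε φ :=
  coreOff_of_envelope_of_room_of_cert_of_soft hE hR hC (softFarFloor_eighth (by norm_num) _ ρ ε φ)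

/-- (E3) at ZERO tables is the landed (H) programme restricted to `η₃`-good instances: `HomFloor φ ⟹ EnvelopeCert η₃ κ κ₁ φ 0 0 0`. [formal bookkeeping] -/
theorem envelopeCert_zero_of_homFloor {φ : ℝ} (η₃ κ κ₁ : ℝ) (h : HomFloor φ) :
    EnvelopeCert η₃ κ κ₁ φ (fun _ _ _ => 0) (fun _ _ _ => 0) (fun _ _ _ => 0) := by
  intro M₀ z₀ c₀ hz₀ hhom _
  have := h M₀ z₀ c₀ hz₀ hhom
  simp only [zero_mul, sub_zero]
  exact this

/-- (E3) is antitone in `φ` and in `η₃` (more instances to certify). [formal bookkeeping] -/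
theorem EnvelopeCert.of_le {η₃ κ κ₁ φ φ' : ℝ} {ℓ s q : (M₀ : ℕ) → (Fin M₀ → E3) → Fin M₀ → ℝ} (h : EnvelopeCert η₃ κ κ₁ φ ℓ s q) (hle : φ' ≤ φ) :
    EnvelopeCert η₃ κ κ₁ φ' ℓ s q :=
  fun M₀ z₀ c₀ hz₀ hhom hg => hle.trans (h M₀ z₀ c₀ hz₀ hhom hg)

/-- `EnvelopeCert` is antitone in `η₃`. [formal bookkeeping] -/
theorem EnvelopeCert.anti {η₃ η₃' κ κ₁ φ : ℝ} {ℓ s q : (M₀ : ℕ) → (Fin M₀ → E3) → Fin M₀ → ℝ} (h : EnvelopeCert η₃' κ κ₁ φ ℓ s q) (hle : η₃ ≤ η₃') :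
    EnvelopeCert η₃ κ κ₁ φ ℓ s q :=
  fun M₀ z₀ c₀ hz₀ hhom hg => h M₀ z₀ c₀ hz₀ hhom (goodAtScale_mono hle hg)

/-- (E2) is antitone in `η₂` (fewer clusters to chart) and monotone in `η₃` (more instances allowed as charts). [formal bookkeeping] -/
theorem ChartRoom.anti {ρ ε η₂ η₂' η₃ τ κ κ₁ : ℝ} (h : ChartRoom ρ ε η₂' η₃ τ κ κ₁) (hle : η₂ ≤ η₂') : ChartRoom ρ ε η₂ η₃ τ κ κ₁ :=
  fun M z c hz hcl hm hn hg => h M z c hz hcl hm hn (goodAtScale_mono hle hg)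

/-- `ChartRoom` is monotone in `η₃`. [formal bookkeeping] -/
theorem ChartRoom.mono {ρ ε η₂ η₃ η₃' τ κ κ₁ : ℝ} (h : ChartRoom ρ ε η₂ η₃ τ κ κ₁) (hle : η₃ ≤ η₃') : ChartRoom ρ ε η₂ η₃' τ κ κ₁ := by
  intro M z c hz hcl hm hn hg
  obtain ⟨R, M₀, z₀, c₀, e, hg₃, ht, hch⟩ := h M z c hz hcl hm hn hg
  exact ⟨R, M₀, z₀, c₀, e, goodAtScale_mono hle hg₃, ht, hch⟩

/-- (E2) transfers DOWN the core-radius ladder and UP the tube width: charting the far class of `(ρ', ε')` charts that of `(ρ, ε)` for `ρ ≤ ρ'`, `ε' ≤ ε` (fewer clusters are far). [formal bookkeeping] -/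
theorem ChartRoom.of_le {ρ ρ' ε ε' η₂ η₃ τ κ κ₁ : ℝ} (h : ChartRoom ρ' ε' η₂ η₃ τ κ κ₁) (hρ : ρ ≤ ρ') (hε : ε' ≤ ε) : ChartRoom ρ ε η₂ η₃ τ κ κ₁ :=
  fun M z c hz hcl hm hn hg => h M z c hz hcl hm (fun hn' => hn ((hn'.of_le_radius hρ).mono hε)) hg

/-! ## §3. The record: `ρ = 24/5`, `ε = 1/100`, every floor `φ₁ ≥ 0` (the assembly consumes any), and the literal `1/1000` -/

/-- ★★ RECORD NODE of this generation (floors universally quantified; Lean fixes no census number):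
`SlavedEnvelope τ ℓ s q → ChartRoom (24/5) (1/100) η₂ η₃ τ κ κ₁ → EnvelopeCert η₃ κ κ₁ φ₁ ℓ s q → SoftFarFloor (63/10) (63/10) (24/5) (1/100) η₂ φ₁ →
CoreOffTubeFloor (63/10) (63/10) (24/5) (1/100) φ₁`. -/
theorem coreOff_record_of_envelope_of_room_of_cert_of_soft {η₂ η₃ τ κ κ₁ φ₁ : ℝ} {ℓ s q : (M₀ : ℕ) → (Fin M₀ → E3) → Fin M₀ → ℝ}
    (hE : SlavedEnvelope τ ℓ s q) (hR : ChartRoom (24 / 5) (1 / 100) η₂ η₃ τ κ κ₁) (hC : EnvelopeCert η₃ κ κ₁ φ₁ ℓ s q)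
    (hS : SoftFarFloor (63 / 10) (63 / 10) (24 / 5) (1 / 100) η₂ φ₁) : CoreOffTubeFloor (63 / 10) (63 / 10) (24 / 5) (1 / 100) φ₁ :=
  coreOff_of_envelope_of_room_of_cert_of_soft hE hR hC hS

/-- ★★ … threaded through the tree's record assembly (m = 1/625, μ = 1/1000, A = 3/5000; ANY residual floor `φ₁ ≥ 0`):
`HomFloor (1/625) → TailPenalty (24/5) (1/1000) → CoreCoreRelief … (3/5000) → (E1) → (E2) → (E3)(φ₁) → SoftFarFloor … η₂ φ₁ → 0 ≤ φ₁ → AnnularPhaseFloor … (1/1000) →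
PolyTextureFloor … (1/1000) → AnnularDefectFloor (24/5) (63/10) → DefectiveCollarFloor (24/5) → StrainedPatchRec`. -/
theorem strainedPatchRec_of_homFloor_625_of_envelope_of_room_of_cert_of_soft {η₂ η₃ τ κ κ₁ φ₁ : ℝ} {ℓ s q : (M₀ : ℕ) → (Fin M₀ → E3) → Fin M₀ → ℝ}
    (hH : HomFloor (1 / 625)) (hT : TailPenalty (24 / 5) (1 / 1000)) (hRl : CoreCoreRelief (63 / 10) (63 / 10) (24 / 5) (1 / 100) (3 / 5000))
    (hE : SlavedEnvelope τ ℓ s q) (hR : ChartRoom (24 / 5) (1 / 100) η₂ η₃ τ κ κ₁) (hC : EnvelopeCert η₃ κ κ₁ φ₁ ℓ s q)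
    (hS : SoftFarFloor (63 / 10) (63 / 10) (24 / 5) (1 / 100) η₂ φ₁) (h₁ : 0 ≤ φ₁) (hF : AnnularPhaseFloor (63 / 10) (24 / 5) (63 / 10) (1 / 1000))
    (hP : PolyTextureFloor (63 / 10) (24 / 5) (1 / 1000)) (hA : AnnularDefectFloor (24 / 5) (63 / 10)) (hD : DefectiveCollarFloor (24 / 5)) :
    StrainedPatchRec :=
  strainedPatchRec_of_homFloor_of_tailPenalty_of_coreRelief_of_coreOff_of_annularPhase_of_poly_of_annular_of_near (by norm_num) hH hT hRl
    seam_arith_core (coreOff_record_of_envelope_of_room_of_cert_of_soft hE hR hC hS) hF hP h₁ (by norm_num) (by norm_num) hA hD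

/-- ★★ … at the literal residual floor `1/1000` of record (the `hC` slot of `…CoreTubeRecord.strainedPatchRec_of_homFloor_625_of_tailPenalty_milli_…`). -/
theorem strainedPatchRec_of_homFloor_625_of_envelope_of_room_of_cert_milli_of_soft {η₂ η₃ τ κ κ₁ : ℝ} {ℓ s q : (M₀ : ℕ) → (Fin M₀ → E3) → Fin M₀ → ℝ}
    (hH : HomFloor (1 / 625)) (hT : TailPenalty (24 / 5) (1 / 1000)) (hRl : CoreCoreRelief (63 / 10) (63 / 10) (24 / 5) (1 / 100) (3 / 5000))
    (hE : SlavedEnvelope τ ℓ s q) (hR : ChartRoom (24 / 5) (1 / 100) η₂ η₃ τ κ κ₁) (hC : EnvelopeCert η₃ κ κ₁ (1 / 1000) ℓ s q)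
    (hS : SoftFarFloor (63 / 10) (63 / 10) (24 / 5) (1 / 100) η₂ (1 / 1000)) (hF : AnnularPhaseFloor (63 / 10) (24 / 5) (63 / 10) (1 / 1000))
    (hP : PolyTextureFloor (63 / 10) (24 / 5) (1 / 1000)) (hA : AnnularDefectFloor (24 / 5) (63 / 10)) (hD : DefectiveCollarFloor (24 / 5)) :
    StrainedPatchRec :=
  strainedPatchRec_of_homFloor_625_of_tailPenalty_milli_of_coreRelief_of_coreOff_of_annularPhase_of_poly_of_annular_of_near hH hT hRl
    (coreOff_record_of_envelope_of_room_of_cert_of_soft hE hR hC hS) hF hP hA hD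

/-- ★ THE TWO-RANGE FORM OF THE RECORD (no engine, bands only): `η₂ ≤ η₁ → EdgeFarFloor … η₁ φ₁ → SoftFarFloor … η₂ φ₁ → CoreOffTubeFloor (63/10) (63/10) (24/5) (1/100) φ₁`. -/
theorem coreOff_record_of_edge_of_soft {η₁ η₂ φ₁ : ℝ} (hle : η₂ ≤ η₁) (hE : EdgeFarFloor (63 / 10) (63 / 10) (24 / 5) (1 / 100) η₁ φ₁)
    (hS : SoftFarFloor (63 / 10) (63 / 10) (24 / 5) (1 / 100) η₂ φ₁) : CoreOffTubeFloor (63 / 10) (63 / 10) (24 / 5) (1 / 100) φ₁ :=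
  coreOff_of_edge_of_soft hle hE hS

/-- The milli variant's residual (`ρ = 111/20`) is cut the same way and implies the record one band by band. [formal bookkeeping] -/
theorem edgeFar_record_of_edgeFar_555 {η₁ φ₁ : ℝ} (h : EdgeFarFloor (63 / 10) (63 / 10) (111 / 20) (1 / 100) η₁ φ₁) :
    EdgeFarFloor (63 / 10) (63 / 10) (24 / 5) (1 / 100) η₁ φ₁ :=
  fun M z c hz hcl hm hn hg => h M z c hz hcl hm (fun hn' => hn (hn'.of_le_radius (by norm_num))) hg

/-- The record instance of the soft far floor from the `111/20` instance. [formal bookkeeping] -/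
theorem softFar_record_of_softFar_555 {η₂ φ₁ : ℝ} (h : SoftFarFloor (63 / 10) (63 / 10) (111 / 20) (1 / 100) η₂ φ₁) :
    SoftFarFloor (63 / 10) (63 / 10) (24 / 5) (1 / 100) η₂ φ₁ :=
  fun M z c hz hcl hm hn hng => h M z c hz hcl hm (fun hn' => hn (hn'.of_le_radius (by norm_num))) hng

end Summit.AtomisticToContinuum.Crystallization.Theorems.FrustratedLawDichotomyStrainedPatchStrainBands
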